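import Mathlib
import HarnessLib
import Literature.Dynamics.Hyperbolic.RGFlowStableManifoldReducedLipschitz
import Literature.Topology.Euclidean.BrouwerNormedSpace

/-!
# The second fixed point of the fine tuning ([ABKM19] Lemma 12.6) by Brouwer's theorem:
# continuity of the tuned trajectory in the parameter suffices when the relevant space is
# finite-dimensional

`RGFlowStableManifoldReducedLipschitz.exists_isTunedQ_initial_eq` obtains the second fixed point
`x_0(h⋆) = h⋆` of [ABKM19] Lemma 12.6 by Banach's theorem: the map `Φ : h ↦ x_0(h)` (the scale-`0`
relevant coordinate of the tuned trajectory of the system `(A^h, B^h, S^h, y₀^h)`) is a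
`½`-contraction of the `ρ`-ball of `E_0` provided the Lipschitz constants `a₀, b₀, l₀, m₀` of the
data in `h` are SMALL (hypothesis `hsmall`).  In the application to gradient models
(`Literature.MathematicalPhysics.StatisticalMechanics.RGStepABKMQ`) the relevant space
`E_0 = M_0(𝓑_0)` is finite-dimensional, and then Brouwer's fixed point theorem
(`Literature.Topology.Euclidean.Brouwer.exists_fixedPoint_closedBall_of_finiteDimensional`) gives
the fixed point from the CONTINUITY of `Φ` on the ball alone: the Lipschitz constants may be
arbitrarily large — in particular they may depend on the volume `N`, which is how the `q`-dependence
of the Gaussian integration `R^{(q)}_{k+1}` (Lemma 8.4, `ℓ = 1`) enters — while every constant in the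
CONCLUSION (`ρ`, `ε`, `η`) stays as in the contraction estimates.  The price is uniqueness of `h⋆`,
which [ABKM19] do not use for Theorem 2.2 / the representation of Ch. 4.

* **`RGFlow.continuousOn_of_norm_sub_le`** — a map with a linear modulus on a ball is continuous
  there (bookkeeping);
* **`RGFlow.exists_isTunedQ_initial_eq_of_finiteDimensional`** — Lemma 12.6 with `hsmall`
  replaced by `FiniteDimensional ℝ (E 0)`: there is `h⋆`, `‖h⋆‖ ≤ ρ`, with a tuned trajectory `x` of
  system `h⋆` in the `ε`-tube and `x_0 = h⋆`.

Everything is proved; no named fact.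

## References
* S. Adams, S. Buchholz, R. Kotecký, S. Müller, arXiv:1910.13564, Lemma 12.6 and its proof
  (12.50)–(12.56), Theorem 12.1 [AdamsBuchholzKoteckyMuller2019].
* T. Tao, *Hilbert's Fifth Problem and Related Topics*, Thm. 6.2.1 (Brouwer) [Tao2014].
-/

noncomputable section

open Set Function Metric Filter
open scoped NNReal Topology

namespace Literature.Dynamics.Hyperbolic

namespace RGFlow

variable {E : ℕ → Type*} [∀ k, NormedAddCommGroup (E k)] [∀ k, NormedSpace ℝ (E k)]
  {F : ℕ → Type*} [∀ k, AddCommGroup (F k)]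

/-- A map with `‖Φ h − Φ h'‖ ≤ Λ‖h − h'‖` on the closed `ρ`-ball is continuous on that ball (any real
`Λ`). [cite: AdamsBuchholzKoteckyMuller2019, Lemma 12.6 (proof, (12.56))] -/
theorem continuousOn_of_norm_sub_le {X : Type*} [NormedAddCommGroup X] {Φ : X → X} {ρ Λ : ℝ}
    (hlip : ∀ h h', ‖h‖ ≤ ρ → ‖h'‖ ≤ ρ → ‖Φ h - Φ h'‖ ≤ Λ * ‖h - h'‖) :
    ContinuousOn Φ (closedBall (0 : X) ρ) := by
  rw [Metric.continuousOn_iff]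
  intro h hh e he
  have hΛ : 0 < max Λ 0 + 1 := by positivity
  refine ⟨e / (max Λ 0 + 1), div_pos he hΛ, fun h' hh' hd => ?_⟩
  rw [mem_closedBall_zero_iff] at hh hh'
  rw [dist_eq_norm] at hd ⊢
  calc ‖Φ h' - Φ h‖ ≤ Λ * ‖h' - h‖ := hlip h' h hh' hh
    _ ≤ (max Λ 0 + 1) * ‖h' - h‖ :=
        mul_le_mul_of_nonneg_right ((le_max_left _ _).trans (le_add_of_nonneg_right zero_le_one))
          (norm_nonneg _)
    _ < (max Λ 0 + 1) * (e / (max Λ 0 + 1)) := mul_lt_mul_of_pos_left hd hΛ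
    _ = e := mul_div_cancel₀ e hΛ.ne'

section secondFixedPointBrouwer

variable [∀ k, CompleteSpace (E k)] {N : ℕ} {r α β σ η κ ε ρ a₀ b₀ l₀ m₀ c₀ : ℝ}
  {Q : ∀ k, F k → ℝ → Prop}
  {A : E 0 → ∀ k, E k ≃L[ℝ] E (k + 1)} {B : E 0 → ∀ k, F k →+ E (k + 1)}
  {S : E 0 → ∀ k, E k → F k → F (k + 1)} {y₀ : E 0 → F 0}

/-- **The second fixed point ([ABKM19] Lemma 12.6) with norm-bound predicates, by Brouwer's
theorem.**  Let `E_0` be finite-dimensional and the system depend on `h ∈ E_0`, `‖h‖ ≤ ρ`: every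
`(A^h, B^h, S^h)` satisfies `IsRGStepQ N r α β σ Q`, the data obey `‖y₀^h‖_0 ≤ c₀ ≤ ε ≤ ρ`, and the
dependence on `h` is Lipschitz with ARBITRARY constants `a₀, b₀, l₀ ≥ 0`, `m₀` —
`‖(A^h_k)⁻¹ − (A^{h'}_k)⁻¹‖ ≤ a₀‖h−h'‖`, `‖(B^h_k − B^{h'}_k) y‖ ≤ b₀‖h−h'‖ ‖y‖_k`,
`‖(S^h_k − S^{h'}_k)(u,v)‖_{k+1} ≤ l₀‖h−h'‖ max(‖u‖, ‖v‖_k)` on the `r`-ball,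
`‖y₀^h − y₀^{h'}‖_0 ≤ m₀‖h−h'‖`.  Then there is `h⋆`, `‖h⋆‖ ≤ ρ`, and a tuned relevant trajectory `x`
of system `h⋆` in the `ε`-tube with `x_0 = h⋆` ((12.50): `Π_{H_0} Ẑ(𝒦, ℋ(𝒦)) = ℋ(𝒦)`).  Compared with
`exists_isTunedQ_initial_eq` the smallness `hsmall` of the constants is not needed (so they may
depend on the volume), at the price of the uniqueness of `h⋆`.
[cite: AdamsBuchholzKoteckyMuller2019, Lemma 12.6] -/
theorem exists_isTunedQ_initial_eq_of_finiteDimensional [FiniteDimensional ℝ (E 0)]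
    (hQ : IsSubaddNormBound Q) (hη : 0 < η) (hη1 : η ≤ 1)
    (hα : 0 ≤ α) (hβ : 0 ≤ β) (hκ₁ : α * (η + β) ≤ κ) (hκ₂ : σ ≤ κ * η)
    (hκ : κ < 1) (hε : 0 ≤ ε) (hεr : ε ≤ r) (hερ : ε ≤ ρ) (ha0 : 0 ≤ a₀) (hb0 : 0 ≤ b₀)
    (hl0 : 0 ≤ l₀) (hc₀ : c₀ ≤ ε)
    (hT : ∀ h : E 0, ‖h‖ ≤ ρ → IsRGStepQ N r α β σ Q (A h) (B h) (S h))
    (hy₀ : ∀ h : E 0, ‖h‖ ≤ ρ → Q 0 (y₀ h) c₀)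
    (ha : ∀ h h' : E 0, ‖h‖ ≤ ρ → ‖h'‖ ≤ ρ → ∀ k, k < N → ∀ w : E (k + 1),
      ‖(A h k).symm w - (A h' k).symm w‖ ≤ a₀ * ‖h - h'‖ * ‖w‖)
    (hb : ∀ h h' : E 0, ‖h‖ ≤ ρ → ‖h'‖ ≤ ρ → ∀ k, k < N → ∀ (v : F k) (c : ℝ), Q k v c →
      ‖B h k v - B h' k v‖ ≤ b₀ * ‖h - h'‖ * c)
    (hl : ∀ h h' : E 0, ‖h‖ ≤ ρ → ‖h'‖ ≤ ρ → ∀ k, k < N → ∀ (u : E k) (v : F k) (c : ℝ),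
      ‖u‖ ≤ r → Q k v c → c ≤ r → Q (k + 1) (S h k u v - S h' k u v) (l₀ * ‖h - h'‖ * max ‖u‖ c))
    (hm : ∀ h h' : E 0, ‖h‖ ≤ ρ → ‖h'‖ ≤ ρ → Q 0 (y₀ h - y₀ h') (m₀ * ‖h - h'‖)) :
    ∃ h : E 0, ‖h‖ ≤ ρ ∧ ∃ x : ∀ k, E k,
      IsTunedQ N (A h) (B h) (S h) (y₀ h) x ∧ InTubeQ N η ε Q (S h) (y₀ h) x ∧ x 0 = h := by
  have hρ : 0 ≤ ρ := hε.trans hερ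
  -- the tuned trajectory of system `h`, by the reduced Theorem 12.1
  have hex : ∀ h : E 0, ‖h‖ ≤ ρ → ∃ x : ∀ k, E k,
      IsTunedQ N (A h) (B h) (S h) (y₀ h) x ∧ InTubeQ N η ε Q (S h) (y₀ h) x := by
    intro h hh
    obtain ⟨x, hN, hrel, htube⟩ := exists_tuned_of_normBound hQ.toIsNormBound (hT h hh) hη hη1 hα
      hβ hκ₁ hκ₂ hκ hε hεr (hy₀ h hh) hc₀
    exact ⟨x, ⟨hN, hrel⟩, htube⟩
  classical
  let Φ : E 0 → E 0 := fun h => if hh : ‖h‖ ≤ ρ then (Classical.choose (hex h hh)) 0 else 0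
  have hΦ : ∀ h (hh : ‖h‖ ≤ ρ), Φ h = (Classical.choose (hex h hh)) 0 := fun h hh => by
    simp only [Φ, dif_pos hh]
  have hmaps : ∀ h, ‖h‖ ≤ ρ → ‖Φ h‖ ≤ ρ := by
    intro h hh
    rw [hΦ h hh]
    obtain ⟨-, htu⟩ := Classical.choose_spec (hex h hh)
    have := (htu 0 (Nat.zero_le _)).1
    rw [pow_zero, mul_one] at this
    exact this.trans hερ
  -- a (possibly huge) linear modulus of `Φ` on the ball, from the comparison of tuned trajectories
  set Λ := max m₀ (max (l₀ * ε / η) ((α * b₀ + a₀ * (η + β + 2 * ρ * b₀)) * ε)) / (1 - κ) with hΛ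
  have hlip : ∀ h h', ‖h‖ ≤ ρ → ‖h'‖ ≤ ρ → ‖Φ h - Φ h'‖ ≤ Λ * ‖h - h'‖ := by
    intro h h' hh hh'
    rw [hΦ h hh, hΦ h' hh']
    obtain ⟨htr, htu⟩ := Classical.choose_spec (hex h hh)
    obtain ⟨htr', htu'⟩ := Classical.choose_spec (hex h' hh')
    set t := ‖h - h'‖ with ht
    have ht0 : 0 ≤ t := norm_nonneg _
    have ht2 : t ≤ 2 * ρ := by
      calc t ≤ ‖h‖ + ‖h'‖ := norm_sub_le _ _
        _ ≤ ρ + ρ := add_le_add hh hh'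
        _ = 2 * ρ := by ring
    have hd := norm_sub_le_of_isTunedQ (a := a₀ * t) (b := b₀ * t) (l := l₀ * t) (m := m₀ * t)
      hQ (hT h hh) hη hη1 hα hβ hκ₁ hκ₂ hκ hε hεr htr htr' htu htu'
      (mul_nonneg ha0 ht0) (mul_nonneg hl0 ht0)
      (fun k hk w => ha h h' hh hh' k hk w) (fun k hk v c hv => hb h h' hh hh' k hk v c hv)
      (fun k hk u v c hu hv hc => hl h h' hh hh' k hk u v c hu hv hc) (hm h h' hh hh')
    have h0 := hd 0 (Nat.zero_le _)
    rw [pow_zero, mul_one] at h0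
    refine h0.trans ?_
    have hP : pertSize α β η ε (a₀ * t) (b₀ * t) (l₀ * t) (m₀ * t) ≤
        t * max m₀ (max (l₀ * ε / η) ((α * b₀ + a₀ * (η + β + 2 * ρ * b₀)) * ε)) := by
      unfold pertSize
      have e1 : m₀ * t = t * m₀ := mul_comm _ _
      have e2 : l₀ * t * ε / η = t * (l₀ * ε / η) := by ring
      have e3 : (α * (b₀ * t) + a₀ * t * (η + β + b₀ * t)) * ε =
          t * ((α * b₀ + a₀ * (η + β + b₀ * t)) * ε) := by ring
      rw [e1, e2, e3, ← mul_max_of_nonneg _ _ ht0, ← mul_max_of_nonneg _ _ ht0]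
      refine mul_le_mul_of_nonneg_left (max_le_max le_rfl (max_le_max le_rfl ?_)) ht0
      refine mul_le_mul_of_nonneg_right (add_le_add le_rfl ?_) hε
      refine mul_le_mul_of_nonneg_left (add_le_add le_rfl ?_) ha0
      calc b₀ * t ≤ b₀ * (2 * ρ) := mul_le_mul_of_nonneg_left ht2 hb0
        _ = 2 * ρ * b₀ := by ring
    have h1κ : 0 < 1 - κ := by linarith
    calc pertSize α β η ε (a₀ * t) (b₀ * t) (l₀ * t) (m₀ * t) / (1 - κ)
        ≤ t * max m₀ (max (l₀ * ε / η) ((α * b₀ + a₀ * (η + β + 2 * ρ * b₀)) * ε)) / (1 - κ) :=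
          div_le_div_of_nonneg_right hP h1κ.le
      _ = Λ * t := by rw [hΛ]; ring
  -- Brouwer
  have hcont : ContinuousOn Φ (closedBall (0 : E 0) ρ) := continuousOn_of_norm_sub_le hlip
  have hmaps' : MapsTo Φ (closedBall (0 : E 0) ρ) (closedBall (0 : E 0) ρ) := fun h hh => by
    rw [mem_closedBall_zero_iff] at hh ⊢
    exact hmaps h hh
  obtain ⟨h, hhB, hfix⟩ :=
    Literature.Topology.Euclidean.Brouwer.exists_fixedPoint_closedBall_of_finiteDimensional
      (c := (0 : E 0)) hρ hcont hmaps'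
  have hh : ‖h‖ ≤ ρ := mem_closedBall_zero_iff.1 hhB
  refine ⟨h, hh, Classical.choose (hex h hh), (Classical.choose_spec (hex h hh)).1,
    (Classical.choose_spec (hex h hh)).2, ?_⟩
  rw [← hΦ h hh]
  exact hfix

end secondFixedPointBrouwer

end RGFlow

end Literature.Dynamics.Hyperbolic

end
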